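import Summits.ValiantsHypothesis.ValiantsHypothesis.Theorems.LacunarySymmetroidMatrixDescartesPivotRankOneFourKillSeven

/-!
# `MatrixDescartes` census — rank-one `(2,4)₁`, ONE below / THREE above: `Z₊ ≤ 8` under the close-type condition (T₀₂)
# (kept degrees `e+d₀, 2e, d₀+d₂, e+d₂`; the last kill-seven set met by the seat's chamber-(C) census)

HONEST FRAMING.  Object-search cell `pub-symmetroid`, seat `val-sym-mdr-p1` (generation 14); helper file `--supports` the crux item
stmt-ValiantsHypothesis-18050 (`Theses.LacunarySymmetroid.MatrixDescartes`, OPEN, on HOLD) with NO closure claim.  Companion of the chamber-(C) files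
`…PivotRankOneOneThreeKillSeven` ((T₀₃),(T₀₁),(T₁₂)), `…KillSevenFar` ((T₁₃)), `…KillSevenS` ((S₀₁₂),(S₀₁₃)), `…OneThreeKillEight` (circuits).  Kept set
`{e+d₀, 2e, d₀+d₂, e+d₂} = {d₀, e} + {e, d₂}`; the killed four-nomial is `A X^{e+d₀} − B X^{2e} + C X^{d₀+d₂} − D X^{e+d₂}` with `B = |det J|·Π_B`,
`D = w₂|m₂|·Π_D`, and the condition is **(T₀₂) `|det J|·Δ₀₂²·Π_BΠ_C ≤ m₀m₂·Π_AΠ_D`** (`σ₀₂ ≤ 4·Π_AΠ_D/(Π_BΠ_C)`: the below letter and letter `2` close in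
angle); `det J < 0`, `m₂ < 0`, `w₀, w₂ > 0`, the rest arbitrary; exponent hypotheses `d₀+d₁ < 2e < d₀+d₂`, `d₀+d₃ < e+d₂`.  Theorems
`elevenNomial_oneThree_T02_le_eight`, `oneThree_rankOne_posRoots_le_eight_of_T02`.  LOCATED (seat exp/coverC_k.py, ≈ 2.1·10⁵ adversarial chamber-(C)
samples × weights): the kernel sets {T₀₃,T₀₁,T₁₂,T₁₃,S₀₁₂,S₀₁₃} ∪ {four circuits} miss 3 samples; (T₀₂) certifies 2 of them; ONE doubly-degenerate sample
(face `d₁+d₂ = e+d₃` within 10⁻⁴, letters `1 ∥ 3` within 2·10⁻³, `Z₊ = 1`) has no grid/circuit certificate — located coverage of (C) is NOT closed and no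
covering is claimed.  Nothing here bears on `MatrixDescartes` in its window, on `DoorA26` / `DoorA34`, registers / credences, or `VP ≠ VNP`.

[folklore] The engine of `…PivotTwoDirectionsBlockLaw`; `2 × 2` determinant algebra.  No definitions, no named facts.
-/

-- `Summit.ValiantsHypothesis.ValiantsHypothesis.…` repeats a component by the D-0017 layout
-- (single-conjunct summit), which the `dupNamespace` linter flags; the name is mandated.
set_option linter.dupNamespace false

namespace Summit.ValiantsHypothesis.ValiantsHypothesis.Theorems.LacunarySymmetroidMatrixDescartes.Pivot.TwoDirections.BlockLaw

open Polynomial Matrix Finset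
open scoped BigOperators

/-- **(T₀₂), real-parameter form** (split `d₀ < e < d₁ < d₂ < d₃`, `d₀+d₁ < 2e < d₀+d₂`, `d₀+d₃ < e+d₂`; `dJ < 0`, `m₂ < 0`, `w₀, w₂ > 0`, the rest arbitrary). -/
theorem elevenNomial_oneThree_T02_le_eight (e d₀ d₁ d₂ d₃ : ℕ) (h0e : d₀ < e) (he1 : e < d₁) (h12 : d₁ < d₂) (h23 : d₂ < d₃)
    (hC1 : d₀ + d₁ < 2 * e) (hC2 : 2 * e < d₀ + d₂) (hC5 : d₀ + d₃ < e + d₂)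
    (dJ m₀ m₁ m₂ m₃ w₀ w₁ w₂ w₃ D01 D02 D03 D12 D13 D23 : ℝ) (hw₀ : 0 < w₀) (hw₂ : 0 < w₂) (hm₂ : m₂ < 0) (hdJ : dJ < 0)
    (hS : (-dJ) * D02
        * (((d₁ : ℝ) - e) * ((d₃ : ℝ) - e) * ((2 : ℝ) * e - d₀ - d₁) * ((d₀ : ℝ) + d₃ - 2 * e) * ((d₁ : ℝ) + d₂ - 2 * e) * ((d₁ : ℝ) + d₃ - 2 * e) * ((d₂ : ℝ) + d₃ - 2 * e))
        * (((e : ℝ) + d₁ - d₀ - d₂) * ((e : ℝ) + d₃ - d₀ - d₂) * ((d₂ : ℝ) - d₁) * ((d₃ : ℝ) - d₂) * ((d₁ : ℝ) - d₀) * ((d₁ : ℝ) + d₃ - d₀ - d₂) * ((d₃ : ℝ) - d₀))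
        ≤ m₀ * m₂
        * (((d₁ : ℝ) - d₀) * ((d₃ : ℝ) - d₀) * ((d₁ : ℝ) - e) * ((d₃ : ℝ) - e) * ((d₁ : ℝ) + d₂ - e - d₀) * ((d₁ : ℝ) + d₃ - e - d₀) * ((d₂ : ℝ) + d₃ - e - d₀))
        * (((d₂ : ℝ) - d₁) * ((d₃ : ℝ) - d₂) * ((e : ℝ) + d₂ - d₀ - d₁) * ((e : ℝ) + d₂ - d₀ - d₃) * ((d₁ : ℝ) - e) * ((d₁ : ℝ) + d₃ - e - d₂) * ((d₃ : ℝ) - e))) :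
    ((∑ i : Fin 11, Polynomial.C ((![dJ, w₀ * m₀, w₁ * m₁, w₂ * m₂, w₃ * m₃, w₀ * w₁ * D01, w₀ * w₂ * D02, w₀ * w₃ * D03, w₁ * w₂ * D12, w₁ * w₃ * D13, w₂ * w₃ * D23] : Fin 11 → ℝ) i) * X ^ ((![2 * e, e + d₀, e + d₁, e + d₂, e + d₃, d₀ + d₁, d₀ + d₂, d₀ + d₃, d₁ + d₂, d₁ + d₃, d₂ + d₃] : Fin 11 → ℕ) i)).roots.toFinset.filter (fun t => 0 < t)).card ≤ 8 := by
  classical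
  have h0e' : (d₀ : ℝ) < e := by exact_mod_cast h0e
  have he1' : (e : ℝ) < d₁ := by exact_mod_cast he1
  have h12' : (d₁ : ℝ) < d₂ := by exact_mod_cast h12
  have h23' : (d₂ : ℝ) < d₃ := by exact_mod_cast h23
  have hC1' : (d₀ : ℝ) + d₁ < 2 * e := by exact_mod_cast hC1
  have hC2' : 2 * (e : ℝ) < d₀ + d₂ := by exact_mod_cast hC2
  have hC5' : (d₀ : ℝ) + d₃ < e + d₂ := by exact_mod_cast hC5
  -- the four distance products (positive atoms)
  obtain ⟨PA, hPA⟩ : ∃ x : ℝ, x = ((d₁ : ℝ) - d₀) * ((d₃ : ℝ) - d₀) * ((d₁ : ℝ) - e) * ((d₃ : ℝ) - e) * ((d₁ : ℝ) + d₂ - e - d₀) * ((d₁ : ℝ) + d₃ - e - d₀) * ((d₂ : ℝ) + d₃ - e - d₀) := ⟨_, rfl⟩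
  obtain ⟨PB, hPB⟩ : ∃ x : ℝ, x = ((d₁ : ℝ) - e) * ((d₃ : ℝ) - e) * ((2 : ℝ) * e - d₀ - d₁) * ((d₀ : ℝ) + d₃ - 2 * e) * ((d₁ : ℝ) + d₂ - 2 * e) * ((d₁ : ℝ) + d₃ - 2 * e) * ((d₂ : ℝ) + d₃ - 2 * e) := ⟨_, rfl⟩
  obtain ⟨PC, hPC⟩ : ∃ x : ℝ, x = ((e : ℝ) + d₁ - d₀ - d₂) * ((e : ℝ) + d₃ - d₀ - d₂) * ((d₂ : ℝ) - d₁) * ((d₃ : ℝ) - d₂) * ((d₁ : ℝ) - d₀) * ((d₁ : ℝ) + d₃ - d₀ - d₂) * ((d₃ : ℝ) - d₀) := ⟨_, rfl⟩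
  obtain ⟨PD, hPD⟩ : ∃ x : ℝ, x = ((d₂ : ℝ) - d₁) * ((d₃ : ℝ) - d₂) * ((e : ℝ) + d₂ - d₀ - d₁) * ((e : ℝ) + d₂ - d₀ - d₃) * ((d₁ : ℝ) - e) * ((d₁ : ℝ) + d₃ - e - d₂) * ((d₃ : ℝ) - e) := ⟨_, rfl⟩
  have hS' : (-dJ) * D02 * PB * PC ≤ m₀ * m₂ * PA * PD := by rw [hPA, hPB, hPC, hPD]; exact hS
  clear hS
  have hPBp : 0 < PB := by
    rw [hPB]
    have f1 : 0 < ((d₁ : ℝ) - e) := by linarith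
    have f2 : 0 < ((d₃ : ℝ) - e) := by linarith
    have f3 : 0 < ((2 : ℝ) * e - d₀ - d₁) := by linarith
    have f4 : 0 < ((d₀ : ℝ) + d₃ - 2 * e) := by linarith
    have f5 : 0 < ((d₁ : ℝ) + d₂ - 2 * e) := by linarith
    have f6 : 0 < ((d₁ : ℝ) + d₃ - 2 * e) := by linarith
    have f7 : 0 < ((d₂ : ℝ) + d₃ - 2 * e) := by linarith
    exact mul_pos (mul_pos (mul_pos (mul_pos (mul_pos (mul_pos f1 f2) f3) f4) f5) f6) f7
  have hPDp : 0 < PD := by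
    rw [hPD]
    have f1 : 0 < ((d₂ : ℝ) - d₁) := by linarith
    have f2 : 0 < ((d₃ : ℝ) - d₂) := by linarith
    have f3 : 0 < ((e : ℝ) + d₂ - d₀ - d₁) := by linarith
    have f4 : 0 < ((e : ℝ) + d₂ - d₀ - d₃) := by linarith
    have f5 : 0 < ((d₁ : ℝ) - e) := by linarith
    have f6 : 0 < ((d₁ : ℝ) + d₃ - e - d₂) := by linarith
    have f7 : 0 < ((d₃ : ℝ) - e) := by linarith
    exact mul_pos (mul_pos (mul_pos (mul_pos (mul_pos (mul_pos f1 f2) f3) f4) f5) f6) f7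
  -- the four surviving coefficients
  obtain ⟨A, hA⟩ : ∃ x : ℝ, x = w₀ * (-m₀) * PA := ⟨_, rfl⟩
  obtain ⟨B, hB⟩ : ∃ x : ℝ, x = (-dJ) * PB := ⟨_, rfl⟩
  obtain ⟨C, hC⟩ : ∃ x : ℝ, x = w₀ * w₂ * D02 * PC := ⟨_, rfl⟩
  obtain ⟨D, hD⟩ : ∃ x : ℝ, x = w₂ * (-m₂) * PD := ⟨_, rfl⟩
  have hBp : 0 < B := by rw [hB]; exact mul_pos (by linarith) hPBp
  have hDp : 0 < D := by rw [hD]; exact mul_pos (mul_pos hw₂ (by linarith)) hPDp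
  have hBC : B * C ≤ A * D := by
    have e1 : B * C = (w₀ * w₂) * ((-dJ) * D02 * PB * PC) := by rw [hB, hC]; ring
    have e2 : A * D = (w₀ * w₂) * (m₀ * m₂ * PA * PD) := by rw [hA, hD]; ring
    rw [e1, e2]
    exact mul_le_mul_of_nonneg_left hS' (mul_pos hw₀ hw₂).le
  -- seven kills
  have hkills := card_posRoots_le_kills (Finset.univ : Finset (Fin 11)) (![2 * e, e + d₀, e + d₁, e + d₂, e + d₃, d₀ + d₁, d₀ + d₂, d₀ + d₃, d₁ + d₂, d₁ + d₃, d₂ + d₃] : Fin 11 → ℕ) [e + d₁, e + d₃, d₀ + d₁, d₀ + d₃, d₁ + d₂, d₁ + d₃, d₂ + d₃] (![dJ, w₀ * m₀, w₁ * m₁, w₂ * m₂, w₃ * m₃, w₀ * w₁ * D01, w₀ * w₂ * D02, w₀ * w₃ * D03, w₁ * w₂ * D12, w₁ * w₃ * D13, w₂ * w₃ * D23] : Fin 11 → ℝ)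
  have hfour : (∑ i ∈ (Finset.univ : Finset (Fin 11)), Polynomial.C ((![dJ, w₀ * m₀, w₁ * m₁, w₂ * m₂, w₃ * m₃, w₀ * w₁ * D01, w₀ * w₂ * D02, w₀ * w₃ * D03, w₁ * w₂ * D12, w₁ * w₃ * D13, w₂ * w₃ * D23] : Fin 11 → ℝ) i
          * (([e + d₁, e + d₃, d₀ + d₁, d₀ + d₃, d₁ + d₂, d₁ + d₃, d₂ + d₃]).map (fun ρ : ℕ => (((((![2 * e, e + d₀, e + d₁, e + d₂, e + d₃, d₀ + d₁, d₀ + d₂, d₀ + d₃, d₁ + d₂, d₁ + d₃, d₂ + d₃] : Fin 11 → ℕ)) i : ℕ) : ℝ) - (ρ : ℝ)))).prod) * X ^ ((![2 * e, e + d₀, e + d₁, e + d₂, e + d₃, d₀ + d₁, d₀ + d₂, d₀ + d₃, d₁ + d₂, d₁ + d₃, d₂ + d₃] : Fin 11 → ℕ) i))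
      = (Polynomial.C A * X ^ (e + d₀) - Polynomial.C B * X ^ (e + d₀ + (e - d₀))
          + Polynomial.C C * X ^ (e + d₀ + (d₂ - e)) - Polynomial.C D * X ^ (e + d₀ + (e - d₀) + (d₂ - e))) := by
    have e3 : e + d₀ + (e - d₀) + (d₂ - e) = e + d₂ := by omega
    have e1 : e + d₀ + (e - d₀) = 2 * e := by omega
    have e2 : e + d₀ + (d₂ - e) = d₀ + d₂ := by omega
    rw [e3, e1, e2]
    have hcoef : ∀ i : Fin 11, (![dJ, w₀ * m₀, w₁ * m₁, w₂ * m₂, w₃ * m₃, w₀ * w₁ * D01, w₀ * w₂ * D02, w₀ * w₃ * D03, w₁ * w₂ * D12, w₁ * w₃ * D13, w₂ * w₃ * D23] : Fin 11 → ℝ) i * (([e + d₁, e + d₃, d₀ + d₁, d₀ + d₃, d₁ + d₂, d₁ + d₃, d₂ + d₃]).map (fun ρ : ℕ => (((((![2 * e, e + d₀, e + d₁, e + d₂, e + d₃, d₀ + d₁, d₀ + d₂, d₀ + d₃, d₁ + d₂, d₁ + d₃, d₂ + d₃] : Fin 11 → ℕ)) i : ℕ) : ℝ) - (ρ : ℝ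)))).prod
        = (![-B, A, 0, -D, 0, 0, C, 0, 0, 0, 0] : Fin 11 → ℝ) i := by
      intro i
      fin_cases i <;>
        simp only [Fin.zero_eta, Fin.mk_one, Fin.isValue, Matrix.cons_val_zero, Matrix.cons_val_one,
          List.map_cons, List.map_nil, List.prod_cons, List.prod_nil, hA, hB, hC, hD, hPA, hPB, hPC, hPD] <;>
        push_cast <;> ring
    rw [Finset.sum_congr rfl (fun i _ => by rw [hcoef i])]
    simp only [Fin.sum_univ_succ, Fin.sum_univ_zero, Matrix.cons_val_zero, Matrix.cons_val_succ, map_zero, zero_mul,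
      zero_add, add_zero, Polynomial.C_neg]
    ring
  rw [hfour] at hkills
  have hone := card_posRoots_fourNomial_le_one A B C D hBp hDp hBC (e + d₀) (e - d₀) (d₂ - e) (by omega)
  simp only [List.length_cons, List.length_nil] at hkills
  omega

/-- **`Z₊ ≤ 8` under (T₀₂)** (matrix form; `det J < 0`, letter `2` pairing negatively with `J`, `w₀, w₂ > 0`). [this file] -/
theorem oneThree_rankOne_posRoots_le_eight_of_T02 (e d₀ d₁ d₂ d₃ : ℕ) (h0e : d₀ < e) (he1 : e < d₁) (h12 : d₁ < d₂) (h23 : d₂ < d₃)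
    (hC1 : d₀ + d₁ < 2 * e) (hC2 : 2 * e < d₀ + d₂) (hC5 : d₀ + d₃ < e + d₂)
    (J : Matrix (Fin 2) (Fin 2) ℝ) (v₀ v₁ v₂ v₃ : Fin 2 → ℝ) (w₀ w₁ w₂ w₃ : ℝ) (hw₀ : 0 < w₀) (hw₂ : 0 < w₂) (hm₂ : (J 0 0 * v₂ 1 ^ 2 + J 1 1 * v₂ 0 ^ 2 - (J 0 1 + J 1 0) * (v₂ 0 * v₂ 1)) < 0) (hJ : J.det < 0)
    (hS : (-J.det) * ((v₀ 0 * v₂ 1 - v₀ 1 * v₂ 0) ^ 2)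
        * (((d₁ : ℝ) - e) * ((d₃ : ℝ) - e) * ((2 : ℝ) * e - d₀ - d₁) * ((d₀ : ℝ) + d₃ - 2 * e) * ((d₁ : ℝ) + d₂ - 2 * e) * ((d₁ : ℝ) + d₃ - 2 * e) * ((d₂ : ℝ) + d₃ - 2 * e))
        * (((e : ℝ) + d₁ - d₀ - d₂) * ((e : ℝ) + d₃ - d₀ - d₂) * ((d₂ : ℝ) - d₁) * ((d₃ : ℝ) - d₂) * ((d₁ : ℝ) - d₀) * ((d₁ : ℝ) + d₃ - d₀ - d₂) * ((d₃ : ℝ) - d₀))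
        ≤ (J 0 0 * v₀ 1 ^ 2 + J 1 1 * v₀ 0 ^ 2 - (J 0 1 + J 1 0) * (v₀ 0 * v₀ 1)) * (J 0 0 * v₂ 1 ^ 2 + J 1 1 * v₂ 0 ^ 2 - (J 0 1 + J 1 0) * (v₂ 0 * v₂ 1))
        * (((d₁ : ℝ) - d₀) * ((d₃ : ℝ) - d₀) * ((d₁ : ℝ) - e) * ((d₃ : ℝ) - e) * ((d₁ : ℝ) + d₂ - e - d₀) * ((d₁ : ℝ) + d₃ - e - d₀) * ((d₂ : ℝ) + d₃ - e - d₀))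
        * (((d₂ : ℝ) - d₁) * ((d₃ : ℝ) - d₂) * ((e : ℝ) + d₂ - d₀ - d₁) * ((e : ℝ) + d₂ - d₀ - d₃) * ((d₁ : ℝ) - e) * ((d₁ : ℝ) + d₃ - e - d₂) * ((d₃ : ℝ) - e))) :
    ((Matrix.det (((X : ℝ[X]) ^ e) • J.map Polynomial.C
        + (Polynomial.C w₀ * X ^ d₀) • (vecMulVec v₀ v₀).map Polynomial.C
        + (Polynomial.C w₁ * X ^ d₁) • (vecMulVec v₁ v₁).map Polynomial.C
        + (Polynomial.C w₂ * X ^ d₂) • (vecMulVec v₂ v₂).map Polynomial.C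
        + (Polynomial.C w₃ * X ^ d₃) • (vecMulVec v₃ v₃).map Polynomial.C)).roots.toFinset.filter (fun t => 0 < t)).card
      ≤ 8 := by
  rw [det_rankOne_four_sum]
  exact elevenNomial_oneThree_T02_le_eight e d₀ d₁ d₂ d₃ h0e he1 h12 h23 hC1 hC2 hC5 J.det _ _ _ _ w₀ w₁ w₂ w₃ _ _ _ _ _ _
    hw₀ hw₂ hm₂ hJ hS

end Summit.ValiantsHypothesis.ValiantsHypothesis.Theorems.LacunarySymmetroidMatrixDescartes.Pivot.TwoDirections.BlockLaw
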